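import Summits.Ventures.WeilGRH.UniformConductorFloorPrincipalLog12
import Summits.Ventures.WeilGRH.UniformConductorFloorJointFloorsLog12
import Summits.Ventures.WeilGRH.UniformConductorFloorPrincipalMod277Log12
import Summits.Ventures.WeilGRH.UniformConductorFloorPrincipalMod293Log12
import HarnessLib

/-!
# GRH arm (rh-explicit, venture WeilGRH): rung six `(log 12)/2` for PRIME moduli — `p ≤ 277` fails, `p ≥ 293` holds (open: `281`, `283`)

Cell `rh-explicit`, WEIL TRACK — GRH ARM (weil-grh-1, gen9).  Assembly of the sixth rung of the principal dichotomy for prime moduli (the prime `11` is inside the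
window) from four kernel-checked inputs: the flat failures `F₁₂` (`UniformConductorFloorPrincipalLog12.lean`: every prime `p ≤ 271`), the TABLE-BASED 40-mode
Galerkin witness for the razor prime `277` (`UniformConductorFloorPrincipalMod277Log12.lean`; flat `271.53 < 277 <` 40-mode bottom `277.08`), the uniform joint-cell floor
`q ≥ 296` (`UniformConductorFloorJointFloorsLog12.lean`) and the principal door cell χ₀ mod `293` (`UniformConductorFloorPrincipalMod293Log12.lean`, λ `0.0193 ∣ 2.22`).
Result: for a prime `p ∉ {281, 283}`, every character mod `p` is Weil-positive on `[-(log 12)/2, (log 12)/2]` iff `p ≥ 281` (equivalently `p ≥ 293`, `p > 277`);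
`277` is SHARP (it fails only by a 40-mode vector — the flat window and 16 modes pass it).  Open: `281`, `283`
(expected TRUE, margins `0.014 / 0.021` over the 32-mode bottom; weil-grh-2's door E on the 128-mode `(log 12)/2` table is not positive definite for them).  Predicted
exact threshold `p*((log 12)/2) = 281` (ladder `79 / 97 / 127 / 173 / 223 / 281?`).  RH/GRH-free; standard axioms; no definitions; no named facts.

## References

* A. Weil (1952), (11) pp. 261–262 and the «lemme» p. 262 [Weil1952FormulesExplicites]; H. Yoshida (1992) §5 [Yoshida1992HermitianForms].
-/

noncomputable section

namespace Summit.Ventures.WeilGRH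

open Literature.NumberTheory.LFunctions

namespace UniformFloor

variable {q : ℕ}

/-- ★★ `U_{(log 12)/2}(293)`: every Dirichlet character mod `293` is Weil-positive on `[−(log 12)/2, (log 12)/2]` (principal door cell, margin `0.0193`).
[cite: Weil1952FormulesExplicites, (11) pp. 261–262] -/
theorem forall_weilPositivityOnChar_log12half_mod_twoNinetyThree (χ : DirichletCharacter ℂ 293) : WeilPositivityOnChar χ (Real.log 12 / 2) := by
  have ha : (0 : ℝ) < Real.log 12 / 2 := by
    have : (1 : ℝ) < 12 := by norm_num
    positivity
  exact WeilPositivityOnChar.of_principal (by norm_num) ha PrincipalMod293Log12.weilPositivityOnChar_log12half_principal_mod_twoNinetyThree χ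

/-- ★ Every character of every PRIME modulus `p ≥ 293` is Weil-positive on `[-(log 12)/2, (log 12)/2]` (cell `293`; uniform floor from `296`).
[cite: Weil1952FormulesExplicites, (11) pp. 261–262 and the «lemme» p. 262] -/
theorem forall_weilPositivityOnChar_log12half_of_prime_ge_293 (hp : q.Prime) (hq : 293 ≤ q) (χ : DirichletCharacter ℂ q) :
    WeilPositivityOnChar χ (Real.log 12 / 2) := by
  by_cases h296 : 296 ≤ q
  · exact weilPositivityOnChar_log12half_of_ge_296 h296 χ
  · have h : q = 293 := by
      have h295 : q ≤ 295 := by omega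
      interval_cases q
      all_goals first | rfl | exact absurd hp (by norm_num)
    subst h
    exact forall_weilPositivityOnChar_log12half_mod_twoNinetyThree χ

/-- ★ **For every prime `p ≤ 277` the principal character mod `p` fails at `(log 12)/2`** (flat for `p ≤ 271`, the table-based 40-mode witness for `277`).
[cite: Weil1952FormulesExplicites, (11) pp. 261–262] -/
theorem not_weilPositivityOnChar_log12half_principal_of_prime_le_277 (hp : q.Prime) (hq : q ≤ 277) :
    ¬ WeilPositivityOnChar (1 : DirichletCharacter ℂ q) (Real.log 12 / 2) := by
  by_cases h271 : q ≤ 271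
  · exact not_weilPositivityOnChar_log12half_principal_of_prime_le hp h271
  · have h277 : q = 277 := by
      by_contra hne
      have h272 : 272 ≤ q := by omega
      have h276 : q ≤ 276 := by omega
      interval_cases q <;> exact absurd hp (by norm_num)
    subst h277
    exact not_weilPositivityOnChar_log12half_principal_mod_277

/-- Below `278`: for a prime `p ≤ 277` some character mod `p` fails on `[-(log 12)/2, (log 12)/2]`, on every window `t ≥ (log 12)/2`. [cite: Weil1952FormulesExplicites, (11) pp. 261–262] -/
theorem exists_not_weilPositivityOnChar_of_log12half_le_of_prime_le_277 (hp : q.Prime) (hq : q ≤ 277) {t : ℝ} (ht : Real.log 12 / 2 ≤ t) :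
    ∃ χ : DirichletCharacter ℂ q, ¬ WeilPositivityOnChar χ t :=
  ⟨1, fun h ↦ not_weilPositivityOnChar_log12half_principal_of_prime_le_277 hp hq (h.mono ht)⟩

/-- ★★ **Rung six for primes outside `{281, 283}`**: every character mod `p` is Weil-positive on `[-(log 12)/2, (log 12)/2]` iff `p ≥ 281`
(equivalently `p > 277`; `277` is sharp). [cite: Weil1952FormulesExplicites, (11) pp. 261–262 and the «lemme» p. 262] -/
theorem forall_weilPositivityOnChar_log12half_iff_of_prime (hp : q.Prime) (h281 : q ≠ 281) (h283 : q ≠ 283) :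
    (∀ χ : DirichletCharacter ℂ q, WeilPositivityOnChar χ (Real.log 12 / 2)) ↔ 281 ≤ q := by
  constructor
  · intro h
    by_contra hlt
    have h277 : q ≤ 277 := by
      by_contra h'
      have h278 : 278 ≤ q := by omega
      have h280 : q ≤ 280 := by omega
      interval_cases q <;> exact absurd hp (by norm_num)
    exact not_weilPositivityOnChar_log12half_principal_of_prime_le_277 hp h277 (h 1)
  · intro h281le χ
    have h293 : 293 ≤ q := by
      by_contra h'
      have h292 : q ≤ 292 := by omega
      interval_cases q
      all_goals first | exact absurd rfl h281 | exact absurd rfl h283 | exact absurd hp (by norm_num)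
    exact forall_weilPositivityOnChar_log12half_of_prime_ge_293 hp h293 χ

end UniformFloor

end Summit.Ventures.WeilGRH

end
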